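/-
Copyright: b2b-lace packet (LEAN TYPING SEAT 1, gen 11).  [FvdH17] §4.2 (4.21)–(4.23) / [NoBLE17] §5.3.2:
the FOURIER SIDE of the bound on `Σ_x 𝒟_{n,n}(x)` — the one- and two-tail pieces of the closed-trail
extraction majorised by SRW-integrals (`a_m(y) ≤ (2d)^m D^{⋆m}(y)` in summed form, then the tree's
`(D^{⋆m} ⋆ τ_p^{⋆j})(x) ≤ Γ̄₂^j K_{j,m}(x)`), the passage `S ↑ ℤ^d`, and the resulting `SumLE` cell
`Σ_x 𝒟_{n,n}(x) ≤ ½·Bound[Bubble, 2n]` FROM the extraction bound (hypothesis `hE`, discharged by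
`DoubleConnectionBubble.two_mul_sum_diagD_le_extraction` in `DoubleConnectionBubbleCell`).
-/
import Literature.Probability.FitznerVanDerHofstad2017.NobleBoundsN0
import Literature.Probability.FitznerVanDerHofstad2017.TrailCounts
import Literature.Probability.FitznerVanDerHofstad2017.SimpleDiagramFourierBound
import Literature.Probability.FitznerVanDerHofstad2017.SrwLawBridges
import HarnessLib

/-!
# [FvdH17] (4.21)–(4.23), Fourier side: `Σ_x 𝒟_{n,n}(x) ≤ ½ · Bound[Bubble, 2n]`

Reproduction module (build `lace`, LEAN-IN-TREE RULE) in the package of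
R. Fitzner, R. van der Hofstad, *Mean-field behavior for nearest-neighbor percolation in `d > 10`*,
Electron. J. Probab. **22** (2017) no. 43 [FvdH17] (arXiv:1506.07977v2), §4.2, paragraph "Bounds on double
connections" (arXiv v2 p. 37 = EJP p. 34), display (4.21) and the sentence following it:

> "… where we recall that `a_m(x)` is the number of `m`-step bond-avoiding walks starting in `0` and ending
> at `x`.  We use that `a_m(x) ≤ b_m(x)`, with `b_m(x)` the number of `m`-step memory-2 SRW paths and
> bound the sum over `u` using (2.21) and (4.10)–(4.11)."

and of the companion R. Fitzner, R. van der Hofstad, *Generalized approach to the non-backtracking lace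
expansion*, Probab. Theory Relat. Fields **169** (2017) [NoBLE17] (arXiv:1506.07969), §5.3.2 first display
(PTRF p. 1097): `(D^{⋆m} ⋆ G_z^{⋆n})(x) ≤ Γ̄₂^n K_{n,m}(x)` (the tree's
`srwConvTau_le_nobleSup2_pow_mul_srwK`, module `SimpleDiagramFourierBound`).

## What this module proves (all kernel-checked; no cited hypothesis)

Write `D = srwStep d` (the SRW step distribution), `τ_p = tau d p 0`, `Γ̄₂ = nobleSup2 d p`,
`K_{j,m}(x) = srwK d j m x`, `a_m(y) = #trailWordsTo d m y`, and let `p < p_c(ℤ^d)`.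

* **A. Trail sums ≤ SRW law** (`sum_trailWords_le`): for `g ≥ 0`,
  `Σ_{u an m-step trail} g(u(m)) ≤ (2d)^m Σ_y D^{⋆m}(y) g(y)` — the summed form of
  "`a_m(y) ≤ b_m(y) ≤ (2d)^m D^{⋆m}(y)`" ([FvdH17] after (4.21); we majorise by ALL `m`-step words, which is
  what the SRW-integral `K_{j,m}` encodes), on top of the word-sum identity `sum_words_eq_pow_mul_tsum`
  (module `SrwLawBridges`).
* **B. One tail** (`sum_trailWords_tau_le`, `d ≥ 3`):
  `Σ_{u ∈ m-trails} τ_p(u(m), 0) ≤ (2d)^m (D^{⋆m} ⋆ τ_p)(0) ≤ (2d)^m Γ̄₂ K_{1,m}(0)`.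
* **C. Two tails, summed over all `x`** (`sum_trailWords_prod_sum_tau_mul_tau_le`, `d ≥ 5`): for every finite
  `S ⊆ ℤ^d`, `Σ_{u₁ ∈ m₁-trails} Σ_{u₂ ∈ m₂-trails} Σ_{x ∈ S} τ_p(u₁(m₁), x) τ_p(u₂(m₂), x)
  ≤ (2d)^{m₁+m₂} (D^{⋆(m₁+m₂)} ⋆ τ_p^{⋆2})(0) ≤ (2d)^{m₁+m₂} Γ̄₂² K_{2,m₁+m₂}(0)`
  (via `Σ_x τ_p(y₁,x)τ_p(y₂,x) = τ_p^{⋆2}(y₁ − y₂)` and `D^{⋆m₁} ⋆ D^{⋆m₂} = D^{⋆(m₁+m₂)}`).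
* **D. The cell** (`sumLE_diagD_bubble`, `d ≥ 5`, `1 ≤ n`, `2n ≤ M`): FROM the extraction bound
  (hypothesis `hE` = the conclusion of `DoubleConnectionBubble.two_mul_sum_diagD_le_extraction`, [FvdH17]
  (4.20)–(4.21) with the factor `1/2`, summed over a finite `S`; discharged in `DoubleConnectionBubbleCell`)
  and letting `S ↑ ℤ^d` (bounded partial sums of a non-negative family),
  `Σ_x 𝒟_{n,n}(x)` is summable and
  `Σ_x 𝒟_{n,n}(x) ≤ ½ · ( Σ_{L=2n}^{M−1} (L+1−2n) a_L(0) p^L + (M−2n) (2dp)^M Γ̄₂ K_{1,M}(0)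
  + (2dp)^M Γ̄₂² K_{2,M}(0) )`, typed as `SumLE (diagD d p n n) (½ · …)`; and the PRINTED-CONSTANT form
  (`sumLE_diagD_bubble_of_le`) with `p ≤ z`, `Γ̄₂ ≤ Γ₂'`:
  `Σ_x 𝒟_{n,n}(x) ≤ ½ · ( Σ_{L=2n}^{M−1} (L+1−2n) a_L(0) z^L + (M−2n) (2dz)^M Γ₂' K_{1,M}(0) + (2dz)^M Γ₂'² K_{2,M}(0) )`
  — literally one half of the notebook cell `Bound[Bubble, 2n, s]` of the authors' `Percolation.nb`
  (closed bond-avoiding walks with multiplicity `j+1−m`, `R'−m` one-tail pieces `(2dz)^{R'} Γ₂' I_{1,R'}(0)`,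
  one two-tail piece `(2dz)^{R'} Γ₂'² I_{2,R'}(0)`; `K_{j,M}(0) = I_{j,M}(0)` for even `M` is the tree's
  `srwK_zero_even`).
* **E. Consumers** live in `DoubleConnectionBubbleCell` (which imports `DoubleConnectionBubble`): the
  unconditional cell and the `N = 0` coefficient bounds of [FvdH17] Lemma 4.2 (4.25) in `SumLE` form,
  `Σ_x Ξ^{(0)}_p(x) ≤ ½·Bound[Bubble,2]`, `Σ_x Ξ^{R,(0)}_p(x) ≤ ½·Bound[Bubble,4]` (transfers
  `sumLE_nobleXiN_zero_of_diagD`, `FvdH17_L42_d423a` of `NobleBoundsN0` / `NoblePercolationSplit`).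

## Reading / divergence notes

* The paper bounds `a_m(x) ≤ b_m(x)` (memory-2 = non-backtracking counts) and then uses the NBW generating
  function (2.21); the notebook cell and this module majorise the tails by the full SRW law `(2d)^m D^{⋆m}`
  (every trail is a word), which is what `(2dz)^{R'} Γ₂'^j I_{j,R'}(0)` in `Bound[Bubble,m,s]` implements.
  This is the same reading as DIVERGENCE D54 (lit-g11) for the explicit part; no new divergence.
* No numerals are evaluated here: `a_L(0) = #trailWordsTo d L 0` and `K_{j,M}(0)` stay symbolic.

[cite: FitznerVanDerHofstad2017, §4.2 (4.20)–(4.23) (arXiv:1506.07977v2 pp. 36–37; EJP 22 (2017) no. 43 p. 34)]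
[cite: FitznerVanDerHofstad2016NoBLE, §5.3.2 first display (PTRF 169 (2017) p. 1097)]
-/

noncomputable section

namespace Literature.Probability.FitznerVanDerHofstad2017

open MeasureTheory Real Finset Filter
open scoped BigOperators
open Literature.Probability.LatticeModels
open Literature.Probability.Percolation
open Literature.Barriers.CriticalPhenomena
open Literature.Barriers.CriticalPhenomena.SpreadOutIsing (delta0 latticeConv convPow latticeConv_comm
  latticeConv_delta0_left latticeConv_delta0 latticeConv_assoc_of_bdd abs_latticeConv_le_of_bdd)

variable {d : ℕ}

/-! ### A. Trail sums are dominated by the SRW law -/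

section WordSums

/-- **`a_m ≤ (2d)^m D^{⋆m}` in summed form**: for `g ≥ 0`,
`Σ_{u an m-step trail} g(u(m)) ≤ (2d)^m Σ_y D^{⋆m}(y) g(y)` (every trail is a word; the word sum is the
SRW law, `sum_words_eq_pow_mul_tsum` of `SrwLawBridges`).
[cite: FitznerVanDerHofstad2017, §4.2 after (4.21) ("a_m(x) ≤ b_m(x) … bound the sum over u") (arXiv:1506.07977v2 p. 37)] -/
theorem sum_trailWords_le {g : Site d → ℝ} (hg0 : ∀ y, 0 ≤ g y) (m : ℕ) :
    ∑ u ∈ trailWords d m, g (wordPos u m) ≤ (2 * d : ℝ) ^ m * ∑' y, convPow (srwStep d) m y * g y := by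
  rw [← sum_words_eq_pow_mul_tsum m g]
  exact Finset.sum_le_sum_of_subset_of_nonneg (Finset.subset_univ _) fun w _ _ => hg0 _

end WordSums

/-! ### B. The one-tail piece: `Σ_u τ_p(u(m), 0) ≤ (2d)^m Γ̄₂ K_{1,m}(0)` -/

section Tails

/-- `τ_p^{⋆1} = τ_p`. [folklore] -/
theorem convPow_tau_one (p : unitInterval) : convPow (tau d p 0) 1 = tau d p 0 :=
  funext fun y => by
    show latticeConv delta0 (tau d p 0) y = _
    rw [latticeConv_delta0_left]

/-- `τ_p^{⋆2} = τ_p ⋆ τ_p`. [folklore] -/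
theorem convPow_tau_two (p : unitInterval) : convPow (tau d p 0) 2 = latticeConv (tau d p 0) (tau d p 0) := by
  show latticeConv (convPow (tau d p 0) 1) (tau d p 0) = _
  rw [convPow_tau_one]

/-- `Σ_y D^{⋆m}(y) τ_p(y, 0) = (D^{⋆m} ⋆ τ_p)(0)`. [folklore] -/
theorem tsum_convPow_mul_tau_eq (p : unitInterval) (m : ℕ) :
    ∑' y, convPow (srwStep d) m y * tau d p y 0 = latticeConv (convPow (srwStep d) m) (tau d p 0) 0 := by
  show _ = ∑' y, convPow (srwStep d) m y * tau d p 0 (0 - y)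
  exact tsum_congr fun y => by rw [zero_sub, tau_zero_neg, tau_comm]

/-- **One tail, SRW form**: `Σ_{u ∈ m-trails} τ_p(u(m), 0) ≤ (2d)^m (D^{⋆m} ⋆ τ_p)(0)`.
[cite: FitznerVanDerHofstad2017, §4.2 (4.21) and the sentence after it (arXiv:1506.07977v2 p. 37)] -/
theorem sum_trailWords_tau_le_srwConvTau (p : unitInterval) (m : ℕ) :
    ∑ u ∈ trailWords d m, tau d p (wordPos u m) 0 ≤
      (2 * d : ℝ) ^ m * latticeConv (convPow (srwStep d) m) (tau d p 0) 0 := by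
  rw [← tsum_convPow_mul_tau_eq]
  exact sum_trailWords_le (g := fun y => tau d p y 0) (fun y => tau_nonneg p y 0) m

/-- **One tail, [NoBLE17] §5.3.2 form**: `Σ_{u ∈ m-trails} τ_p(u(m), 0) ≤ (2d)^m Γ̄₂ K_{1,m}(0)`
(`d ≥ 3`, `p < p_c`). [cite: FitznerVanDerHofstad2016NoBLE, §5.3.2 first display (PTRF 169 (2017) p. 1097)] -/
theorem sum_trailWords_tau_le (hd : 3 ≤ d) (p : unitInterval) (hp : p < criticalProbI d) (m : ℕ) :
    ∑ u ∈ trailWords d m, tau d p (wordPos u m) 0 ≤ (2 * d : ℝ) ^ m * (nobleSup2 d p * srwK d 1 m 0) := by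
  refine (sum_trailWords_tau_le_srwConvTau p m).trans (mul_le_mul_of_nonneg_left ?_ (by positivity))
  have h := srwConvTau_le_nobleSup2_pow_mul_srwK (n := 1) (by omega) (by omega) p hp m 0
  rwa [convPow_tau_one, pow_one] at h

/-! ### C. The two-tail piece summed over all `x`: `≤ (2d)^{m₁+m₂} Γ̄₂² K_{2,m₁+m₂}(0)` -/

/-- `|D(y)| ≤ 1`. [folklore] -/
theorem abs_srwStep_le_one' (y : Site d) : |srwStep d y| ≤ 1 := by
  rw [abs_of_nonneg (srwStep_nonneg y)]
  unfold srwStep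
  split_ifs
  · rcases Nat.eq_zero_or_pos d with h | h
    · simp [h]
    · rw [div_le_one (by positivity)]
      exact_mod_cast (show 1 ≤ 2 * d by omega)
  · exact zero_le_one

/-- **`D^{⋆m} ⋆ D^{⋆n} = D^{⋆(m+n)}`** (pointwise). [folklore] -/
theorem convPow_srwStep_add_apply (m : ℕ) :
    ∀ (n : ℕ) (x : Site d), latticeConv (convPow (srwStep d) m) (convPow (srwStep d) n) x =
      convPow (srwStep d) (m + n) x
  | 0, x => by
    show latticeConv (convPow (srwStep d) m) delta0 x = convPow (srwStep d) m x
    rw [latticeConv_delta0]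
  | n + 1, x => by
    have ih : latticeConv (convPow (srwStep d) m) (convPow (srwStep d) n) = convPow (srwStep d) (m + n) :=
      funext fun y => convPow_srwStep_add_apply m n y
    show latticeConv (convPow (srwStep d) m) (latticeConv (convPow (srwStep d) n) (srwStep d)) x =
      latticeConv (convPow (srwStep d) (m + n)) (srwStep d) x
    rw [← latticeConv_assoc_of_bdd (summable_convPow_srwStep m).abs (summable_convPow_srwStep n).abs
      abs_srwStep_le_one' x, ih]

/-- `Σ_x τ_p(y₁, x) τ_p(y₂, x) = τ_p^{⋆2}(y₂ − y₁)` (translation invariance and symmetry of `τ_p`).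
[cite: FitznerVanDerHofstad2017, §4.2 (4.21)–(4.23) (arXiv:1506.07977v2 p. 37)] -/
theorem tsum_tau_mul_tau_eq (p : unitInterval) (y₁ y₂ : Site d) :
    ∑' x, tau d p y₁ x * tau d p y₂ x = convPow (tau d p 0) 2 (y₂ - y₁) := by
  rw [convPow_tau_two]
  show _ = ∑' z, tau d p 0 z * tau d p 0 (y₂ - y₁ - z)
  rw [← (Equiv.addRight y₁).tsum_eq]
  refine tsum_congr fun z => ?_
  simp only [Equiv.coe_addRight]
  rw [tau_eq_tau_zero_sub p y₁, tau_eq_tau_zero_sub p y₂, add_sub_cancel_right,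
    show z + y₁ - y₂ = -(y₂ - y₁ - z) by abel, tau_zero_neg]

/-- The summand `x ↦ τ_p(y₁, x) τ_p(y₂, x)` is summable below `p_c`. [folklore] -/
theorem summable_tau_mul_tau (hd : 2 ≤ d) (p : unitInterval) (hp : p < criticalProbI d) (y₁ y₂ : Site d) :
    Summable fun x => tau d p y₁ x * tau d p y₂ x := by
  have hp' : (p : ℝ) < criticalProb (zdGraph d) (0 : Site d) := hp
  have hs : Summable fun x => tau d p 0 (x - y₂) :=
    (summable_tau_of_lt_criticalProb hd p hp').comp_injective (sub_left_injective (b := y₂))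
  refine hs.of_nonneg_of_le (fun x => mul_nonneg (tau_nonneg p _ _) (tau_nonneg p _ _)) fun x => ?_
  rw [← tau_eq_tau_zero_sub p y₂ x]
  exact mul_le_of_le_one_left (tau_nonneg p _ _) (tau_le_one p _ _)

/-- `0 ≤ τ_p^{⋆2}` and `τ_p^{⋆2} ≤ Σ_y τ_p(y)` pointwise (below `p_c`). [folklore] -/
theorem abs_convPow_tau_two_le (hd : 2 ≤ d) (p : unitInterval) (hp : p < criticalProbI d) (y : Site d) :
    |convPow (tau d p 0) 2 y| ≤ (∑' z, |tau d p 0 z|) * 1 := by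
  have hp' : (p : ℝ) < criticalProb (zdGraph d) (0 : Site d) := hp
  rw [convPow_tau_two]
  exact abs_latticeConv_le_of_bdd (summable_tau_of_lt_criticalProb hd p hp').abs
    (fun x => by rw [abs_of_nonneg (tau_nonneg p 0 x)]; exact tau_le_one p 0 x) y

/-- **Two tails summed over a finite set of `x`, SRW form**:
`Σ_{u₁ ∈ m₁-trails} Σ_{u₂ ∈ m₂-trails} Σ_{x ∈ S} τ_p(u₁(m₁), x) τ_p(u₂(m₂), x) ≤ (2d)^{m₁+m₂} (D^{⋆(m₁+m₂)} ⋆ τ_p^{⋆2})(0)`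
(`d ≥ 2`, `p < p_c`). [cite: FitznerVanDerHofstad2017, §4.2 (4.21)–(4.23) (arXiv:1506.07977v2 p. 37)] -/
theorem sum_trailWords_prod_sum_tau_mul_tau_le_srwConvTau (hd : 2 ≤ d) (p : unitInterval)
    (hp : p < criticalProbI d) (m₁ m₂ : ℕ) (S : Finset (Site d)) :
    ∑ uu ∈ (trailWords d m₁) ×ˢ (trailWords d m₂), ∑ x ∈ S, tau d p (wordPos uu.1 m₁) x * tau d p (wordPos uu.2 m₂) x ≤
      (2 * d : ℝ) ^ (m₁ + m₂) * latticeConv (convPow (srwStep d) (m₁ + m₂)) (convPow (tau d p 0) 2) 0 := by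
  set B : Site d → ℝ := convPow (tau d p 0) 2 with hB
  have hB0 : ∀ y, 0 ≤ B y := fun y => convPow_tau_nonneg p 2 y
  have hBb : ∀ y, |B y| ≤ (∑' z, |tau d p 0 z|) * 1 := abs_convPow_tau_two_le hd p hp
  have hBsym : ∀ y, B (-y) = B y := fun y => IsZdSymmetric.neg (isZdSymmetric_convPow_tau p 2) y
  -- `H = D^{⋆m₂} ⋆ τ^{⋆2}`
  set H : Site d → ℝ := latticeConv (convPow (srwStep d) m₂) B with hH
  have hH0 : ∀ y, 0 ≤ H y := fun y =>
    tsum_nonneg fun z => mul_nonneg (convPow_srwStep_nonneg m₂ z) (hB0 _)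
  have hHsym : ∀ y, H (-y) = H y := fun y => IsZdSymmetric.neg (isZdSymmetric_srwConvTau p m₂ 2) y
  -- step 1: the `x`-sum is at most `B(u₂(m₂) − u₁(m₁))`
  have h1 : ∀ y₁ y₂ : Site d, ∑ x ∈ S, tau d p y₁ x * tau d p y₂ x ≤ B (y₂ - y₁) := fun y₁ y₂ => by
    rw [hB, ← tsum_tau_mul_tau_eq]
    exact (summable_tau_mul_tau hd p hp y₁ y₂).sum_le_tsum S fun x _ =>
      mul_nonneg (tau_nonneg p _ _) (tau_nonneg p _ _)
  -- step 2: the `u₂`-sum of `B(u₂(m₂) − y₁)` is at most `(2d)^{m₂} H(y₁)`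
  have h2 : ∀ y₁ : Site d, ∑ u₂ ∈ trailWords d m₂, B (wordPos u₂ m₂ - y₁) ≤ (2 * d : ℝ) ^ m₂ * H y₁ := by
    intro y₁
    refine (sum_trailWords_le (g := fun y => B (y - y₁)) (fun y => hB0 _) m₂).trans (le_of_eq ?_)
    congr 1
    show _ = ∑' y, convPow (srwStep d) m₂ y * B (y₁ - y)
    exact tsum_congr fun y => by rw [← hBsym (y - y₁), neg_sub]
  -- step 3: the `u₁`-sum of `H(u₁(m₁))` is at most `(2d)^{m₁} (D^{⋆m₁} ⋆ H)(0)`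
  have h3 : ∑ u₁ ∈ trailWords d m₁, H (wordPos u₁ m₁) ≤
      (2 * d : ℝ) ^ m₁ * latticeConv (convPow (srwStep d) m₁) H 0 := by
    refine (sum_trailWords_le hH0 m₁).trans (le_of_eq ?_)
    congr 1
    show _ = ∑' y, convPow (srwStep d) m₁ y * H (0 - y)
    exact tsum_congr fun y => by rw [zero_sub, hHsym]
  -- step 4: `D^{⋆m₁} ⋆ (D^{⋆m₂} ⋆ B) = D^{⋆(m₁+m₂)} ⋆ B`
  have h4 : latticeConv (convPow (srwStep d) m₁) H 0 =
      latticeConv (convPow (srwStep d) (m₁ + m₂)) B 0 := by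
    rw [hH, ← latticeConv_assoc_of_bdd (summable_convPow_srwStep m₁).abs (summable_convPow_srwStep m₂).abs hBb 0]
    congr 1
    exact funext fun y => convPow_srwStep_add_apply m₁ m₂ y
  -- assemble
  calc ∑ uu ∈ (trailWords d m₁) ×ˢ (trailWords d m₂), ∑ x ∈ S, tau d p (wordPos uu.1 m₁) x * tau d p (wordPos uu.2 m₂) x
      ≤ ∑ uu ∈ (trailWords d m₁) ×ˢ (trailWords d m₂), B (wordPos uu.2 m₂ - wordPos uu.1 m₁) :=
        Finset.sum_le_sum fun uu _ => h1 _ _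
    _ = ∑ u₁ ∈ trailWords d m₁, ∑ u₂ ∈ trailWords d m₂, B (wordPos u₂ m₂ - wordPos u₁ m₁) := Finset.sum_product _ _ _
    _ ≤ ∑ u₁ ∈ trailWords d m₁, (2 * d : ℝ) ^ m₂ * H (wordPos u₁ m₁) := Finset.sum_le_sum fun u₁ _ => h2 _
    _ = (2 * d : ℝ) ^ m₂ * ∑ u₁ ∈ trailWords d m₁, H (wordPos u₁ m₁) := by rw [Finset.mul_sum]
    _ ≤ (2 * d : ℝ) ^ m₂ * ((2 * d : ℝ) ^ m₁ * latticeConv (convPow (srwStep d) m₁) H 0) :=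
        mul_le_mul_of_nonneg_left h3 (by positivity)
    _ = (2 * d : ℝ) ^ (m₁ + m₂) * latticeConv (convPow (srwStep d) (m₁ + m₂)) B 0 := by
        rw [h4, pow_add]; ring

/-- **Two tails summed over a finite set of `x`, [NoBLE17] §5.3.2 form**:
`… ≤ (2d)^{m₁+m₂} Γ̄₂² K_{2,m₁+m₂}(0)` (`d ≥ 5`, `p < p_c`).
[cite: FitznerVanDerHofstad2016NoBLE, §5.3.2 first display (PTRF 169 (2017) p. 1097)] -/
theorem sum_trailWords_prod_sum_tau_mul_tau_le (hd : 5 ≤ d) (p : unitInterval) (hp : p < criticalProbI d)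
    (m₁ m₂ : ℕ) (S : Finset (Site d)) :
    ∑ uu ∈ (trailWords d m₁) ×ˢ (trailWords d m₂), ∑ x ∈ S, tau d p (wordPos uu.1 m₁) x * tau d p (wordPos uu.2 m₂) x ≤
      (2 * d : ℝ) ^ (m₁ + m₂) * (nobleSup2 d p ^ 2 * srwK d 2 (m₁ + m₂) 0) :=
  (sum_trailWords_prod_sum_tau_mul_tau_le_srwConvTau (by omega) p hp m₁ m₂ S).trans
    (mul_le_mul_of_nonneg_left (srwConvTau_le_nobleSup2_pow_mul_srwK (n := 2) (by omega) (by omega) p hp _ 0)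
      (by positivity))

end Tails

/-! ### D. `S ↑ ℤ^d` and the Bubble cell, from the extraction bound

The closed-trail extraction (4.20)–(4.21) summed over `x ∈ S` is the statement
`DoubleConnectionBubble.two_mul_sum_diagD_le_extraction` of the packet's literature seat (gen 11); it is
taken here as the HYPOTHESIS `hE` (its literal conclusion, with `idxTwoTail n M` unfolded to
`trailWords d (M − n) ×ˢ trailWords d n`) and DISCHARGED by that kernel theorem in the follow-up module
`DoubleConnectionBubbleCell` — `hE` is NOT a cited fact (ABSOLUTE RULE: nothing programme-internal is
cited; the theorems below are plain implications). -/

section Cell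

variable {p : unitInterval} {n M : ℕ}
  (hE : ∀ S : Finset (Site d), 2 * ∑ x ∈ S, diagD d p n n x ≤
    (∑ L ∈ Finset.Ico (2 * n) M,
        ((Finset.Icc n (L - n)).card : ℝ) * ((trailWordsTo d L 0).card : ℝ) * (p : ℝ) ^ L) +
      ((Finset.Ico n (M - n)).card : ℝ) * ((p : ℝ) ^ M * ∑ u ∈ trailWords d M, tau d p (wordPos u M) 0) +
        (p : ℝ) ^ (M - n) * (p : ℝ) ^ n *
          ∑ uu ∈ (trailWords d (M - n)) ×ˢ (trailWords d n),
            ∑ x ∈ S, tau d p (wordPos uu.1 (M - n)) x * tau d p (wordPos uu.2 n) x)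

/-- A non-negative family with uniformly bounded finite partial sums is `SumLE`. [folklore] -/
theorem sumLE_of_finset_sum_le {f : Site d → ℝ} (hf : ∀ x, 0 ≤ f x) {β : ℝ}
    (h : ∀ S : Finset (Site d), ∑ x ∈ S, f x ≤ β) : SumLE f β :=
  ⟨summable_of_sum_le (fun x => hf x) h, Real.tsum_le_of_sum_le (fun x => hf x) h⟩

include hE

/-- **[FvdH17] (4.21)–(4.23) with SRW-integral tails, all finite `S`** (`d ≥ 5`, `p < p_c`, `1 ≤ n`, `2n ≤ M`;
from the extraction bound `hE` = (4.20)–(4.21) summed over `x ∈ S`):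
`2 Σ_{x∈S} 𝒟_{n,n}(x) ≤ Σ_{L=2n}^{M−1} (L+1−2n) a_L(0) p^L + (M−2n) (2dp)^M Γ̄₂ K_{1,M}(0) + (2dp)^M Γ̄₂² K_{2,M}(0)`.
[cite: FitznerVanDerHofstad2017, §4.2 (4.20)–(4.23) (arXiv:1506.07977v2 pp. 36–37)]
[cite: FitznerVanDerHofstad2016NoBLE, §5.3.2 first display (PTRF 169 (2017) p. 1097)] -/
theorem two_mul_sum_diagD_le_bubble (hd : 5 ≤ d) (hp : p < criticalProbI d) (hn : 1 ≤ n) (hM : 2 * n ≤ M)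
    (S : Finset (Site d)) :
    2 * ∑ x ∈ S, diagD d p n n x ≤
      (∑ L ∈ Finset.Ico (2 * n) M, ((L + 1 - 2 * n : ℕ) : ℝ) * ((trailWordsTo d L 0).card : ℝ) * (p : ℝ) ^ L) +
        ((M - 2 * n : ℕ) : ℝ) * ((2 * d * (p : ℝ)) ^ M * (nobleSup2 d p * srwK d 1 M 0)) +
          (2 * d * (p : ℝ)) ^ M * (nobleSup2 d p ^ 2 * srwK d 2 M 0) := by
  classical
  have hp0 : 0 ≤ (p : ℝ) := p.2.1
  have hMn : M - n + n = M := by omega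
  refine (hE S).trans ?_
  refine add_le_add (add_le_add (le_of_eq ?_) ?_) ?_
  · refine Finset.sum_congr rfl fun L _ => ?_
    rw [Nat.card_Icc]
    congr 3
    omega
  · rw [Nat.card_Ico]
    have hc : M - n - n = M - 2 * n := by omega
    rw [hc]
    refine mul_le_mul_of_nonneg_left ?_ (Nat.cast_nonneg _)
    calc (p : ℝ) ^ M * ∑ u ∈ trailWords d M, tau d p (wordPos u M) 0
        ≤ (p : ℝ) ^ M * ((2 * d : ℝ) ^ M * (nobleSup2 d p * srwK d 1 M 0)) :=
          mul_le_mul_of_nonneg_left (sum_trailWords_tau_le (by omega) p hp M) (pow_nonneg hp0 M)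
      _ = (2 * d * (p : ℝ)) ^ M * (nobleSup2 d p * srwK d 1 M 0) := by rw [mul_pow]; ring
  · calc (p : ℝ) ^ (M - n) * (p : ℝ) ^ n *
          ∑ uu ∈ (trailWords d (M - n)) ×ˢ (trailWords d n),
            ∑ x ∈ S, tau d p (wordPos uu.1 (M - n)) x * tau d p (wordPos uu.2 n) x
        ≤ (p : ℝ) ^ (M - n) * (p : ℝ) ^ n * ((2 * d : ℝ) ^ (M - n + n) * (nobleSup2 d p ^ 2 * srwK d 2 (M - n + n) 0)) :=
          mul_le_mul_of_nonneg_left (sum_trailWords_prod_sum_tau_mul_tau_le hd p hp (M - n) n S)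
            (mul_nonneg (pow_nonneg hp0 _) (pow_nonneg hp0 _))
      _ = (2 * d * (p : ℝ)) ^ M * (nobleSup2 d p ^ 2 * srwK d 2 M 0) := by
          rw [hMn, ← pow_add, hMn, mul_pow]; ring

/-- **The Bubble cell: `Σ_x 𝒟_{n,n}(x) ≤ ½ · Bound[Bubble, 2n]` with SRW-integral tails** (`d ≥ 5`,
`p < p_c`, `1 ≤ n`, `2n ≤ M`; from the extraction bound `hE`): `Σ_x 𝒟_{n,n}(x)` is summable (bounded partial sums
of a non-negative family: `S ↑ ℤ^d`) and
`Σ_x 𝒟_{n,n}(x) ≤ ½ ( Σ_{L=2n}^{M−1} (L+1−2n) a_L(0) p^L + (M−2n) (2dp)^M Γ̄₂ K_{1,M}(0) + (2dp)^M Γ̄₂² K_{2,M}(0) )`.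
[cite: FitznerVanDerHofstad2017, §4.2 (4.20)–(4.23) (arXiv:1506.07977v2 pp. 36–37; EJP 22 (2017) no. 43 p. 34)]
[cite: FitznerVanDerHofstad2016NoBLE, §5.3.2 first display (PTRF 169 (2017) p. 1097)] -/
theorem sumLE_diagD_bubble (hd : 5 ≤ d) (hp : p < criticalProbI d) (hn : 1 ≤ n) (hM : 2 * n ≤ M) :
    SumLE (diagD d p n n)
      (1 / 2 * ((∑ L ∈ Finset.Ico (2 * n) M, ((L + 1 - 2 * n : ℕ) : ℝ) * ((trailWordsTo d L 0).card : ℝ) * (p : ℝ) ^ L) +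
        ((M - 2 * n : ℕ) : ℝ) * ((2 * d * (p : ℝ)) ^ M * (nobleSup2 d p * srwK d 1 M 0)) +
          (2 * d * (p : ℝ)) ^ M * (nobleSup2 d p ^ 2 * srwK d 2 M 0))) := by
  refine sumLE_of_finset_sum_le (fun x => diagD_nonneg p n n x) fun S => ?_
  have h := two_mul_sum_diagD_le_bubble hE hd hp hn hM S
  linarith

/-- **The Bubble cell in printed constants** (`p ≤ z`, `Γ̄₂ ≤ Γ₂'`; `d ≥ 5`, `p < p_c`, `1 ≤ n`, `2n ≤ M`; from `hE`):
`Σ_x 𝒟_{n,n}(x) ≤ ½ ( Σ_{L=2n}^{M−1} (L+1−2n) a_L(0) z^L + (M−2n) (2dz)^M Γ₂' K_{1,M}(0) + (2dz)^M Γ₂'² K_{2,M}(0) )`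
— one half of the notebook cell `Bound[Bubble, 2n, s]` (`K_{j,M}(0) = I_{j,M}(0)` for even `M`,
`srwK_zero_even`). [cite: FitznerVanDerHofstad2017, §4.2 (4.20)–(4.23) (arXiv:1506.07977v2 pp. 36–37; EJP 22 (2017) no. 43 p. 34)]
[cite: FitznerVanDerHofstad2016NoBLE, §5.3.2 first display and "Numeric: Bubble" (PTRF 169 (2017) p. 1097)] -/
theorem sumLE_diagD_bubble_of_le (hd : 5 ≤ d) (hp : p < criticalProbI d) (hn : 1 ≤ n) (hM : 2 * n ≤ M)
    {z Γ₂' : ℝ} (hz : (p : ℝ) ≤ z) (hΓ : nobleSup2 d p ≤ Γ₂') :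
    SumLE (diagD d p n n)
      (1 / 2 * ((∑ L ∈ Finset.Ico (2 * n) M, ((L + 1 - 2 * n : ℕ) : ℝ) * ((trailWordsTo d L 0).card : ℝ) * z ^ L) +
        ((M - 2 * n : ℕ) : ℝ) * ((2 * d * z) ^ M * (Γ₂' * srwK d 1 M 0)) +
          (2 * d * z) ^ M * (Γ₂' ^ 2 * srwK d 2 M 0))) := by
  obtain ⟨hs, hle⟩ := sumLE_diagD_bubble hE hd hp hn hM
  refine ⟨hs, hle.trans ?_⟩
  have hp0 : 0 ≤ (p : ℝ) := p.2.1
  have hz0 : 0 ≤ z := hp0.trans hz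
  have hG0 : 0 ≤ nobleSup2 d p := nobleSup2_nonneg' p
  have hG0' : 0 ≤ Γ₂' := hG0.trans hΓ
  have hK1 : 0 ≤ srwK d 1 M 0 := srwK_nonneg 1 M 0
  have hK2 : 0 ≤ srwK d 2 M 0 := srwK_nonneg 2 M 0
  have hdp0 : 0 ≤ 2 * d * (p : ℝ) := mul_nonneg (mul_nonneg zero_le_two (Nat.cast_nonneg d)) hp0
  have hdp : 2 * d * (p : ℝ) ≤ 2 * d * z :=
    mul_le_mul_of_nonneg_left hz (mul_nonneg zero_le_two (Nat.cast_nonneg d))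
  have hpow : (2 * d * (p : ℝ)) ^ M ≤ (2 * d * z) ^ M := pow_le_pow_left₀ hdp0 hdp M
  refine mul_le_mul_of_nonneg_left (add_le_add (add_le_add ?_ ?_) ?_) (by norm_num)
  · exact Finset.sum_le_sum fun L _ => mul_le_mul_of_nonneg_left (pow_le_pow_left₀ hp0 hz L)
      (mul_nonneg (Nat.cast_nonneg _) (Nat.cast_nonneg _))
  · refine mul_le_mul_of_nonneg_left ?_ (Nat.cast_nonneg _)
    exact mul_le_mul hpow (mul_le_mul_of_nonneg_right hΓ hK1) (mul_nonneg hG0 hK1) (pow_nonneg (hdp0.trans hdp) M)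
  · exact mul_le_mul hpow (mul_le_mul_of_nonneg_right (pow_le_pow_left₀ hG0 hΓ 2) hK2)
      (mul_nonneg (pow_nonneg hG0 2) hK2) (pow_nonneg (hdp0.trans hdp) M)

/-- **The Bubble cell with the printed constants `Γ₁, Γ₂`** (`(2d−1)p ≤ Γ₁`, `sup_k p|D̂_p(k)| ≤ Γ₂`;
[NoBLE17] §5.3.1 `(2dp)^m ≤ ((2d/(2d−1))Γ₁)^m`, (5.13) `Γ̄₂ ≤ (2d−2)/(2d−1) Γ₂`; from `hE`).
[cite: FitznerVanDerHofstad2016NoBLE, §5.3.1 and (5.13) (PTRF 169 (2017) pp. 1091, 1096–1097)]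
[cite: FitznerVanDerHofstad2017, §4.2 (4.20)–(4.23) (arXiv:1506.07977v2 pp. 36–37)] -/
theorem sumLE_diagD_bubble_printed (hd : 5 ≤ d) (hp : p < criticalProbI d) (hn : 1 ≤ n) (hM : 2 * n ≤ M)
    {Γ₁ Γ₂ : ℝ} (hΓ1 : (2 * d - 1) * (p : ℝ) ≤ Γ₁) (hΓ2 : nobleF2 d p ≤ Γ₂) :
    SumLE (diagD d p n n)
      (1 / 2 * ((∑ L ∈ Finset.Ico (2 * n) M, ((L + 1 - 2 * n : ℕ) : ℝ) * ((trailWordsTo d L 0).card : ℝ) * (p : ℝ) ^ L) +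
        ((M - 2 * n : ℕ) : ℝ) * ((2 * d / (2 * d - 1) * Γ₁) ^ M * ((2 * d - 2) / (2 * d - 1) * Γ₂ * srwK d 1 M 0)) +
          (2 * d / (2 * d - 1) * Γ₁) ^ M * (((2 * d - 2) / (2 * d - 1) * Γ₂) ^ 2 * srwK d 2 M 0))) := by
  obtain ⟨hs, hle⟩ := sumLE_diagD_bubble hE hd hp hn hM
  refine ⟨hs, hle.trans ?_⟩
  have hp0 : 0 ≤ (p : ℝ) := p.2.1
  have hG0 : 0 ≤ nobleSup2 d p := nobleSup2_nonneg' p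
  have hΓ : nobleSup2 d p ≤ (2 * d - 2) / (2 * d - 1) * Γ₂ := nobleSup2_le_of_nobleF2_le (by omega) p hΓ2
  have hG0' : 0 ≤ (2 * d - 2) / (2 * d - 1) * Γ₂ := hG0.trans hΓ
  have hK1 : 0 ≤ srwK d 1 M 0 := srwK_nonneg 1 M 0
  have hK2 : 0 ≤ srwK d 2 M 0 := srwK_nonneg 2 M 0
  have hdp : 2 * d * (p : ℝ) ≤ 2 * d / (2 * d - 1) * Γ₁ := two_d_mul_le_of_le (by omega) p hΓ1
  have hdp0 : 0 ≤ 2 * d * (p : ℝ) := mul_nonneg (mul_nonneg zero_le_two (Nat.cast_nonneg d)) hp0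
  have hpow : (2 * d * (p : ℝ)) ^ M ≤ (2 * d / (2 * d - 1) * Γ₁) ^ M := pow_le_pow_left₀ hdp0 hdp M
  refine mul_le_mul_of_nonneg_left (add_le_add (add_le_add le_rfl ?_) ?_) (by norm_num)
  · refine mul_le_mul_of_nonneg_left ?_ (Nat.cast_nonneg _)
    exact mul_le_mul hpow (mul_le_mul_of_nonneg_right hΓ hK1) (mul_nonneg hG0 hK1) (pow_nonneg (hdp0.trans hdp) M)
  · exact mul_le_mul hpow (mul_le_mul_of_nonneg_right (pow_le_pow_left₀ hG0 hΓ 2) hK2)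
      (mul_nonneg (pow_nonneg hG0 2) hK2) (pow_nonneg (hdp0.trans hdp) M)

end Cell

end Literature.Probability.FitznerVanDerHofstad2017

end
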